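import Mathlib
import Summits.Langlands.Langlands.Theorems.PicardMuOrdinaryResidualAutomorphyOddGaloisSide
import Summits.Langlands.Langlands.Theorems.PicardMuOrdinaryResidualAutomorphyOddPerPrime
import Summits.Langlands.Langlands.Theorems.PicardMuOrdinaryResidualAutomorphyOddAutomorphic
import Summits.Langlands.Langlands.Theses.PicardMuOrdinary
import HarnessLib

/-!
# `ResidualAutomorphyOdd` (item stmt-Langlands-13759, route PicardMuOrdinary) — conditional proof

The route decl `Summit.Langlands.Langlands.Theses.PicardMuOrdinary.ResidualAutomorphyOdd`, proved from six
named facts: Tate's lifting theorem (`Tate_projectiveLifting`), Serre's conjecture in the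
Khare–Wintenberger form (`khare_wintenberger 3 𝔽̄₃`), cyclic base change (`baseChange_cyclic_cuspidal`),
Arthur–Clozel's archimedean strong lifting (`ArthurClozel1989_strongLifting_archimedean`) — tree facts —
and the two archimedean facts of `…Facts` (`GelbartJacquet_adjoint_lift_archimedean`,
`newform_archParameter`).  Galois side: `…GaloisSide.galoisSide`; automorphic side:
`…Automorphic.automorphicSide`; per-prime matching: `…PerPrime.perPrime`.
-/

set_option linter.dupNamespace false -- project-wide option (lakefile weak.linter.dupNamespace); `Summit.Langlands.Langlands` is the mandated namespace

noncomputable section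

open scoped NumberField Classical Polynomial MatrixGroups
open Filter IsDedekindDomain Polynomial
open Literature.NumberTheory.Automorphic Literature.NumberTheory.GaloisRepresentations
open Literature.NumberTheory.EllipticCurves.ModularForms

namespace Summit.Langlands.Langlands.Theorems.ResidualAutomorphyOdd

/-- **`ResidualAutomorphyOdd`, conditionally.** The route decl
`Summit.Langlands.Langlands.Theses.PicardMuOrdinary.ResidualAutomorphyOdd` follows from Tate's lifting
theorem, Serre's conjecture (Khare–Wintenberger form, `p = 3`), cyclic base change, Arthur–Clozel's
archimedean strong lifting, the Gelbart–Jacquet archimedean clause and the archimedean parameter of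
newforms: the Galois side produces `σ̄`, `ω`, the sign recipe and the table identities; Khare–Wintenberger
gives a newform `g` of weight `≥ 2` with `ρ̄_g ≅ σ̄`; the automorphic side gives `P` on `GL₃/ℚ(ω)`; the
maximal ideal `𝔐 ∋ 3` of `ℤ̄` lies over the kernel of the reduction of the coefficient integers of `g`;
and `perPrime` matches the Hecke polynomials with the table at every good place. -/
theorem ResidualAutomorphyOdd_of_facts (hTate : Tate_projectiveLifting)
    (hKW : khare_wintenberger 3 K3) (hGJ : GelbartJacquet_adjoint_lift_archimedean)
    (hNF : newform_archParameter)
    (hBC : baseChange_cyclic_cuspidal) (hAC : ArthurClozel1989_strongLifting_archimedean) :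
    Summit.Langlands.Langlands.Theses.PicardMuOrdinary.ResidualAutomorphyOdd := by
  intro f hcpt hdeg hsep hgal hreal
  classical
  obtain ⟨σ, ω, s, S, hirr, hodd, hωfin, hωs, hND, htab⟩ := galoisSide hTate f hdeg hsep hgal hreal
  -- Khare–Wintenberger: a newform `g` of weight `w ≥ 2` with `ρ̄_g ≅ σ`
  obtain ⟨loc⟩ := nonempty_localRestrictionAt 3 σ
  obtain ⟨ιr⟩ := nonempty_ringHom_residue (k := K3) 3 loc.F loc.residueFieldCard_eq
  haveI hN0 : NeZero (ModPGaloisRep.serreLevel 3 σ) :=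
    ⟨fun h => ModPGaloisRep.not_dvd_serreLevel 3 σ (h ▸ dvd_zero 3)⟩
  obtain ⟨g, ιg, hg, hρ⟩ := hKW σ hirr hodd loc ιr
  have hw : 2 ≤ ModPGaloisRep.serreWeight 3 σ loc ιr :=
    ModPGaloisRep.two_le_serreWeightLocal_holds loc.rep ιr
  obtain ⟨P, hPra, hP⟩ := automorphicSide hGJ hNF hBC hAC hw hg (nonDihedral hρ hND) ω hωfin hcpt
  obtain ⟨𝔐, h𝔐max, h𝔐comap, h3𝔐⟩ := exists_maximal_over_ker g ιg
  refine ⟨P, 𝔐, hPra, h𝔐max, h3𝔐, ?_⟩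
  -- the good places of `K`
  have hbadQ : {v : HeightOneSpectrum (𝓞 ℚ) |
      ((Rat.HeightOneSpectrum.primesEquiv v : Nat.Primes) : ℕ) ∈ (↑S : Set ℕ) ∪
        {q : ℕ | q ∣ ModPGaloisRep.serreLevel 3 σ * 3}}.Finite := by
    have hT : ((↑S : Set ℕ) ∪ {q : ℕ | q ∣ ModPGaloisRep.serreLevel 3 σ * 3}).Finite :=
      S.finite_toSet.union ((Nat.divisors (ModPGaloisRep.serreLevel 3 σ * 3)).finite_toSet.subset
        fun q hq => Nat.mem_divisors.2 ⟨hq, mul_ne_zero (NeZero.ne _) (by norm_num)⟩)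
    exact hT.preimage fun x _ y _ hxy =>
      (Rat.HeightOneSpectrum.primesEquiv (R := 𝓞 ℚ)).injective (Subtype.ext hxy)
  have hgood : ∀ᶠ 𝔭 : HeightOneSpectrum (𝓞 Kω) in cofinite, ∀ v : HeightOneSpectrum (𝓞 ℚ),
      𝔭.asIdeal.under (𝓞 ℚ) = v.asIdeal →
        ((Rat.HeightOneSpectrum.primesEquiv v : Nat.Primes) : ℕ) ∉ S ∧
          ¬ ((Rat.HeightOneSpectrum.primesEquiv v : Nat.Primes) : ℕ) ∣ ModPGaloisRep.serreLevel 3 σ * 3 := by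
    rw [Filter.eventually_cofinite]
    refine (finite_setOf_under_mem hbadQ).subset ?_
    intro 𝔭 h𝔭
    simp only [Set.mem_setOf_eq, not_forall, exists_prop] at h𝔭
    obtain ⟨v, hv, h⟩ := h𝔭
    refine ⟨v, ?_, hv⟩
    simp only [Set.mem_setOf_eq, Set.mem_union, Finset.mem_coe]
    tauto
  filter_upwards [hP, hgood] with 𝔭 h𝔭 hg𝔭
  obtain ⟨α, x, y, v, hunder, hSat, hxy, hxy', hε, hα⟩ := h𝔭
  obtain ⟨hpS, hpN⟩ := hg𝔭 v hunder
  obtain ⟨Q, hQ1, hQ2⟩ := perPrime f hωs htab hw hρ h𝔐comap hunder hpS hpN hxy hxy' hε hα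
  exact ⟨α, Q, hSat, hQ1, hQ2⟩

end Summit.Langlands.Langlands.Theorems.ResidualAutomorphyOdd
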